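import Summits.Ventures.DiscreteObjects.PP12.TwoThreeGroupReduction
import Summits.Ventures.DiscreteObjects.PP12.CyclicCollineationGroup

/-!
# PP(12): the Janko–van Trung named fact IS the three plane-level cells `p = 5, 11, 13` (kernel; bookkeeping)
Framing: lottery ticket; floor = certified bounds/negative ranges.

Cell pub-namedobj (venture DiscreteObjects), target (M), designs gen 15. `twoThreeGroup_iff_cells`: given the kernel prime atlas
(`prime_mem_of_collineation_order12`: prime orders of collineations of a projective plane of order 12 lie in `{2, 3, 5, 11, 13}`), the named fact
`CollineationGroupIsTwoThreeGroup` (Janko–van Trung 1982) is EQUIVALENT to the conjunction of the plane-level cell statements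
`NoOrderFiveOrder12 ∧ NoOrderElevenOrder12 ∧ NoOrderThirteenOrder12` (`TwoThreeGroupReduction` ⇐, `CyclicCollineationGroup` ⇒). So the census may
trade the named fact for exactly these three cells, of which `p = 5` is reduced in the kernel to the finite statement `NoFanoFiveIncMatrix`
(`FanoFiveIncReduction`). Nothing here asserts either side. No `sorry`, no new axioms.
-/

namespace Summit.Ventures.DiscreteObjects.PP12

open Literature.Combinatorics.Designs in
/-- The named fact gives the order-11 cell. -/
theorem noOrderEleven_of_twoThreeGroup (hJvT : CollineationGroupIsTwoThreeGroup) : NoOrderElevenOrder12 :=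
  fun P L _ _ _ _ h12 σ hq => eq_one_of_twoThreeGroup hJvT P L h12 σ (by norm_num) (by norm_num) (by norm_num) hq

open Literature.Combinatorics.Designs in
/-- The named fact gives the order-13 cell. -/
theorem noOrderThirteen_of_twoThreeGroup (hJvT : CollineationGroupIsTwoThreeGroup) : NoOrderThirteenOrder12 :=
  fun P L _ _ _ _ h12 σ hq => eq_one_of_twoThreeGroup hJvT P L h12 σ (by norm_num) (by norm_num) (by norm_num) hq

open Literature.Combinatorics.Designs in
/-- **Janko–van Trung's `{2,3}`-group theorem ⟺ the three plane-level prime cells `p = 5, 11, 13`** (given the kernel atlas). -/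
theorem twoThreeGroup_iff_cells :
    CollineationGroupIsTwoThreeGroup ↔ NoOrderFiveOrder12 ∧ NoOrderElevenOrder12 ∧ NoOrderThirteenOrder12 :=
  ⟨fun h => ⟨noOrderFive_of_twoThreeGroup h, noOrderEleven_of_twoThreeGroup h, noOrderThirteen_of_twoThreeGroup h⟩,
    fun h => collineationGroupIsTwoThreeGroup_of_cells h.1 h.2.1 h.2.2⟩

end Summit.Ventures.DiscreteObjects.PP12
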